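import Summits.PneNP.PneNP.Theorems.ReslinSizeFromWidthPCDegreeConsequences
import Literature.Computability.MetaComplexity.ExpandingCNFDegree
import HarnessLib

/-!
# PneNP / ReslinSizeFromWidth — the PC rail for EXPANDING CNFs (Alekhnovich–Razborov input, unconditional)

Helper file for the INPUT side of crux `ResLinSizeFromWidth` (stmt-PneNP-18932).  The PC rail
(`ReslinSizeFromWidthPCDegree.lean`, `…Consequences.lean`) turns a PC/`𝔽₂` degree lower bound for
the clause polynomials of a CNF into Res(⊕) rank, clause-space, tree-like-size and quadratic
dag-like-size lower bounds.  `Literature/…/ExpandingCNFDegree.lean` now PROVES the most general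
classical degree input — Alekhnovich–Razborov's theorem for CNFs whose clause–variable incidence
graph is a unique-neighbour expander (Mikša–Nordström 2015, Thm 4.2:
`PC.not_refutableInDegree_of_isBoundaryExpander`).  Plugging it in: for a CNF `φ` of width `≤ t`
(`CNF.IsWidthLE`) whose clause scopes form an `(s, δ)`-boundary expander (`s ≥ 2`, `δ > 0`;
`IsBoundaryExpander (PC.clauseScope φ) s δ`) and an integer `D ≤ δs/2`,

* every Res(⊕) refutation (semantic weakening) of `φ` has a line of rank `≥ D` if `t ≤ D`
  (`resLinWidth_expandingCNF`, `le_minResLinWidth_expandingCNF`) — the Res(⊕) analogue of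
  Ben-Sasson–Wigderson's resolution width bound for expanding CNFs, obtained through PC degree
  ("all previously known lower bounds on width/rank were based on polynomial calculus degree lower
  bounds", Efremenko–Garlík–Itsykson 2024);
* clause space `≥ D + 1 - t`, tree-like size `≥ 2^(D-t-1)`, and `2 + (D-1)D ≤ 2|π| + t(t+1)` for
  every refutation `π` (`clauseSpace_expandingCNF`, `treeLike_length_expandingCNF`,
  `quadratic_length_expandingCNF`; `t < D` for the first and last).

Not here: that random `k`-CNF of constant density is such an expander w.h.p. (Chvátal–Szemerédi /
Ben-Sasson–Wigderson §6 — not in the tree as a clause–variable boundary-expansion statement).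

References: M. Alekhnovich, A. Razborov, FOCS 2001; M. Mikša, J. Nordström, CCC 2015, Thm 4.2;
K. Efremenko, M. Garlík, D. Itsykson, STOC 2024, §1.2.
-/

noncomputable section

namespace Summit.PneNP.PneNP.Theorems

-- `Summit.PneNP.PneNP` repeats a path component by design (summit = sub-problem); silence the linter.
set_option linter.dupNamespace false

namespace ResLinPC

open Literature.Computability.Complexity Literature.Computability.MetaComplexity
open Summit.PneNP.PneNP.Theorems.PolyCalc

variable (φ : CNF ℕ) {s δ : ℝ} {t D : ℕ}

/-- **Alekhnovich–Razborov over `𝔽₂` for the rail**: the clause polynomials of an `(s, δ)`-expanding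
CNF (`s ≥ 2`, `δ > 0`) have no PC refutation of degree `≤ D ≤ δs/2`. [Mikša–Nordström 2015, Thm 4.2
— proved in `ExpandingCNFDegree.lean`] -/
theorem not_refutableInDegree_expandingCNF (hs : 2 ≤ s) (hδ : 0 < δ)
    (hG : IsBoundaryExpander (PC.clauseScope φ) s δ) (hD : (D : ℝ) ≤ δ * s / 2) :
    ¬ PC.RefutableInDegree (cnfPolys (ZMod 2) φ) D := by
  rw [show cnfPolys (ZMod 2) φ = PC.ofCNF (ZMod 2) φ from rfl]
  exact PC.not_refutableInDegree_of_isBoundaryExpander φ hs hδ hG hD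

/-- **Res(⊕) rank of expanding CNFs**: width `≤ t ≤ D ≤ δs/2` ⇒ every Res(⊕) refutation of `φ`
contains a line of rank `≥ D`. [Efremenko–Garlík–Itsykson 2024, §1.2 (the indirect route);
Mikša–Nordström 2015, Thm 4.2] -/
theorem resLinWidth_expandingCNF (hs : 2 ≤ s) (hδ : 0 < δ)
    (hG : IsBoundaryExpander (PC.clauseScope φ) s δ) (hφ : φ.IsWidthLE t) (htD : t ≤ D)
    (hD : (D : ℝ) ≤ δ * s / 2) {π : List ResLinLine} (hπ : IsResLinRefutation φ π) :
    D ≤ resLinWidth π :=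
  resLin_rank_of_pcDegree (fun c hc => (hφ c hc).trans htD)
    (not_refutableInDegree_expandingCNF φ hs hδ hG hD) hπ

/-- The same for the minimal refutation width (`ℕ∞`). [Efremenko–Garlík–Itsykson 2024, §1.2] -/
theorem le_minResLinWidth_expandingCNF (hs : 2 ≤ s) (hδ : 0 < δ)
    (hG : IsBoundaryExpander (PC.clauseScope φ) s δ) (hφ : φ.IsWidthLE t) (htD : t ≤ D)
    (hD : (D : ℝ) ≤ δ * s / 2) : (D : ℕ∞) ≤ minResLinWidth φ :=
  le_minResLinWidth_iff.2 fun _ hπ => resLinWidth_expandingCNF φ hs hδ hG hφ htD hD hπ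

/-- **Res(⊕) clause space of expanding CNFs**: width `≤ t < D ≤ δs/2` ⇒ clause space `≥ D + 1 - t`.
[Gryaznov–Ovcharov–Riazanov 2024, Cor. 1 with Thm 6 (shape)] -/
theorem clauseSpace_expandingCNF (hs : 2 ≤ s) (hδ : 0 < δ)
    (hG : IsBoundaryExpander (PC.clauseScope φ) s δ) (hφ : φ.IsWidthLE t) (htD : t + 1 ≤ D)
    (hD : (D : ℝ) ≤ δ * s / 2) {ϖ : List (Finset LinClause)} (hϖ : IsResLinSpaceRefutation φ ϖ) :
    D + 1 - t ≤ resLinClauseSpace ϖ :=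
  clauseSpace_of_pcDegree hφ htD (not_refutableInDegree_expandingCNF φ hs hδ hG hD) hϖ

/-- **Tree-like Res(⊕) size of expanding CNFs**: width `≤ t ≤ D ≤ δs/2` ⇒ every tree-like Res(⊕)
refutation has `≥ 2^(D - t - 1)` lines. [Efremenko–Garlík–Itsykson 2024, §1.1.1 (the method)] -/
theorem treeLike_length_expandingCNF (hs : 2 ≤ s) (hδ : 0 < δ)
    (hG : IsBoundaryExpander (PC.clauseScope φ) s δ) (hφ : φ.IsWidthLE t) (htD : t ≤ D)
    (hD : (D : ℝ) ≤ δ * s / 2) {π : List ResLinLine} (hπ : IsResLinRefutation φ π)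
    (htree : ∀ i : ℕ, (π.map fun l => l.premises.count i).sum ≤ 1) : 2 ^ (D - t - 1) ≤ π.length :=
  treeLike_length_of_pcDegree hφ htD (not_refutableInDegree_expandingCNF φ hs hδ hG hD) hπ htree

/-- **Dag-like Res(⊕) size of expanding CNFs, quadratic law**: width `≤ t < D ≤ δs/2` ⇒
`2 + (D-1)D ≤ 2|π| + t(t+1)` for every Res(⊕) refutation `π`. [the tree's quadratic law] -/
theorem quadratic_length_expandingCNF (hs : 2 ≤ s) (hδ : 0 < δ)
    (hG : IsBoundaryExpander (PC.clauseScope φ) s δ) (hφ : φ.IsWidthLE t) (htD : t + 1 ≤ D)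
    (hD : (D : ℝ) ≤ δ * s / 2) {π : List ResLinLine} (hπ : IsResLinRefutation φ π) :
    2 + (D - 1) * D ≤ 2 * π.length + t * (t + 1) :=
  quadratic_length_of_pcDegree hφ htD (not_refutableInDegree_expandingCNF φ hs hδ hG hD) hπ

end ResLinPC

end Summit.PneNP.PneNP.Theorems
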